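import Mathlib
import Summits.NavierStokesRegularity.FluidComputer.LaplacianConvectFlux
import Literature.Analysis.FunctionSpaces.TorusLinearisedNSEnergy
import Literature.Analysis.FunctionSpaces.TorusLinearisedFormTruncation
import HarnessLib

/-!
# Sharp `H²` transport and stretching fluxes with FROBENIUS-structured host constants (cap g5, cell `ns-blowup`, 2026-08-26) — part 1 of the sharp form of THEOREM 3-L's tail inequality

HONEST FRAMING (human ruling D-0035): nothing here is a claim about Navier–Stokes blow-up.
WHAT THIS IS NOT: not NS evidence. `H2TailDissipativity.tail_form_le` (instab g8, p410014) proves the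
tail inequality of THEOREM 3-L (`instab/INSTAB-BRIDGE.md` §11 l.109) with ENTRYWISE host bounds
`‖∂ₖv‖ ≤ L`, `‖∂ⱼ∂ₖv‖ ≤ L'`, `‖∂ⱼΔv‖ ≤ L''`, whose top-order constant `(2d² + d)L` is `21` for the
rescaled ABC host and does NOT certify at the D2 certificate's `K = 24` (`cap/D2-CHAIN-MAP.md` step
S7 (a): «the sharp paper derivation is load-bearing»). This file proves the SAME inequality with the
host entering only through five pointwise STRUCTURAL constants — Cauchy–Schwarz is done in `ℓ²`
(Frobenius) instead of `ℓ¹ × ℓ^∞`: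

* `s`  — strain:      `|⟪(a·∇)v(x), a⟫| ≤ s‖a‖²` for all `x`, `a` (symmetric part of `∇v`);
* `F`  — gradient:    `∑ⱼ ‖∂ⱼv(x)‖² ≤ F²` (Frobenius norm of `∇v`);
* `L₂` — Laplacian:   `‖Δv(x)‖ ≤ L₂`;
* `P`  — Hessian:     `∑ₘ∑ⱼ ‖∂ⱼ∂ₘv(x)‖² ≤ P²`;
* `Q`  — `∇Δ`:        `∑ⱼ ‖∂ⱼΔv(x)‖² ≤ Q²`.

This part proves the two FLUX halves; the sequel `SharpH2TailDissipativity` adds the high-mode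
Poincaré factors and assembles the tail inequality
`ν∫⟪ΔΔw, Δw⟫ − ∫⟪(v·∇)w + (w·∇)v, ΔΔw⟫ − ωY ≤ (−νΛ − ω + (2F + s) + (L₂ + 2P)Λ^{-1/2} + QΛ^{-1}) · Y`.
For `U = abc(1,1,1)` on `(ℝ/2πℤ)³` the five constants are `s = √2` (Lemma S,
`SkewCutCertificate.abc_strain_form_abs_le`), `F = √3` (`|∇U|_F² = 3` pointwise), `L₂ = √6`
(`ΔU = −U`, `|U|² ≤ 6`), `P = √3` (pure second derivatives of unit length, mixed ones zero,
`AbcH2TailConstants.abc_dxx_sq`), `Q = √3` (`∇ΔU = −∇U`), giving EXACTLY the paper's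
`c₀ = 2√3 + √2`, `c₁ = √6 + 2√3`, `c₂ = √3` used by `AbcKappa0TailLevels` / the D2 certificates
(after the `2π`-rescaling to the unit torus, which multiplies a `j`-th derivative constant by `(2π)ʲ`
and `Λ^{1/2}` plays `2π(K+1)`; that instantiation sentence stays S7 (c)).

* `norm_sum_convect_le_sqrt_mul_sqrt` — pointwise `‖∑ₘ (Aₘ·∇)Bₘ‖ ≤ (∑ₘ‖Aₘ‖²)^{1/2}(∑ₘ∑ⱼ‖∂ⱼBₘ‖²)^{1/2}`.
* `abs_integral_inner_convect_bilaplacian_le_frob` — transport half: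
  `|∫⟪(v·∇)w, ΔΔw⟫| ≤ (2F·‖Δw‖₂ + L₂·‖∇w‖₂)·‖Δw‖₂` (vs `2L·ΣΣ‖∂∂w‖₂ + L₂·Σ‖∂w‖₂` entrywise in
  `LaplacianConvectFlux.abs_integral_inner_convect_bilaplacian_le`).
* `abs_integral_inner_stretch_bilaplacian_le_frob` — stretching half:
  `|∫⟪(w·∇)v, ΔΔw⟫| ≤ (Q‖w‖₂ + 2P‖∇w‖₂ + s‖Δw‖₂)·‖Δw‖₂` (vs `d(L''‖w‖₂ + 2L'Σ‖∂w‖₂ + L‖Δw‖₂)`).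

Mathlib + the landed torus calculus (`LaplacianConvectCommutator`, `LaplacianConvectFlux`, `Torus*`);
no new definitions.
-/

noncomputable section

namespace Summit.NavierStokesRegularity.FluidComputer.SharpH2Fluxes

open Literature.Analysis.FunctionSpaces Literature.Analysis.FunctionSpaces.Torus MeasureTheory
open Summit.NavierStokesRegularity.FluidComputer.LaplacianConvectCommutator
open scoped RealInnerProductSpace

variable {d : Type*} [Fintype d] [DecidableEq d]
variable {F : Type*} [NormedAddCommGroup F] [NormedSpace ℝ F]

/-! ## Pointwise Frobenius bounds -/

/-- **Frobenius bound for a sum of convective derivatives.** For fields `Aₘ : T^d → ℝ^d` and `C¹`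
fields `Bₘ : T^d → F`, pointwise
`‖∑ₘ (Aₘ·∇)Bₘ(x)‖ ≤ (∑ₘ ‖Aₘ(x)‖²)^{1/2} · (∑ₘ ∑ⱼ ‖∂ⱼBₘ(x)‖²)^{1/2}`
(Cauchy–Schwarz in `j` inside each convective derivative, then in `m`). -/
theorem norm_sum_convect_le_sqrt_mul_sqrt (A : d → UnitAddTorus d → EuclideanSpace ℝ d)
    {B : d → UnitAddTorus d → F} (hB : ∀ m, IsContDiff 1 (B m)) (x : UnitAddTorus d) :
    ‖∑ m, convect (A m) (B m) x‖
      ≤ Real.sqrt (∑ m, ‖A m x‖ ^ 2)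
        * Real.sqrt (∑ m, ∑ j, ‖partialDeriv j (B m) x‖ ^ 2) := by
  have h1 : ‖∑ m, convect (A m) (B m) x‖
      ≤ ∑ m, ‖A m x‖ * Real.sqrt (∑ j, ‖partialDeriv j (B m) x‖ ^ 2) :=
    (norm_sum_le _ _).trans (Finset.sum_le_sum fun m _ => norm_convect_le_norm_mul_sqrt (hB m) (A m) x)
  have h2 : ∑ m, ‖A m x‖ * Real.sqrt (∑ j, ‖partialDeriv j (B m) x‖ ^ 2)
      ≤ Real.sqrt (∑ m, ‖A m x‖ ^ 2)
        * Real.sqrt (∑ m, (Real.sqrt (∑ j, ‖partialDeriv j (B m) x‖ ^ 2)) ^ 2) :=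
    Real.sum_mul_le_sqrt_mul_sqrt _ _ _
  have h3 : ∑ m, (Real.sqrt (∑ j, ‖partialDeriv j (B m) x‖ ^ 2)) ^ 2
      = ∑ m, ∑ j, ‖partialDeriv j (B m) x‖ ^ 2 :=
    Finset.sum_congr rfl fun m _ => Real.sq_sqrt (Finset.sum_nonneg fun j _ => sq_nonneg _)
  rw [h3] at h2
  exact h1.trans h2

/-! ## The transport half -/

/-- **Sharp `H²` transport flux (Frobenius host constants).** For smooth divergence-free `v` with
`∑ⱼ‖∂ⱼv(x)‖² ≤ F²`, `‖Δv(x)‖ ≤ L₂` and smooth `w`: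
`|∫ ⟪(v·∇)w, ΔΔw⟫| ≤ (2F·‖Δw‖₂ + L₂·‖∇w‖₂)·‖Δw‖₂` with `‖∇w‖₂² = gradNormSq w`, `‖Δw‖₂² = ∫‖Δw‖²`.
Green's second identity and the `H²` skew identity (`integral_inner_laplacian_convect_laplacian`)
leave `∫⟪2∑ₘ(∂ₘv·∇)∂ₘw + (Δv·∇)w, Δw⟫`; the first term is bounded pointwise by
`2F·(∑ₘ∑ⱼ‖∂ⱼ∂ₘw‖²)^{1/2}` and `∑ₘ∑ⱼ∫‖∂ⱼ∂ₘw‖² = ∫‖Δw‖²` (`sum_gradNormSq_partialDeriv_eq`). -/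
theorem abs_integral_inner_convect_bilaplacian_le_frob {v w : UnitAddTorus d → EuclideanSpace ℝ d}
    (hv : IsSmooth v) (hdiv : IsDivFree v) (hw : IsSmooth w) {F L₂ : ℝ} (hF0 : 0 ≤ F)
    (hF : ∀ x : UnitAddTorus d, ∑ j, ‖partialDeriv j v x‖ ^ 2 ≤ F ^ 2)
    (hL₂ : ∀ x : UnitAddTorus d, ‖laplacian v x‖ ≤ L₂) :
    |∫ x, ⟪convect v w x, laplacian (laplacian w) x⟫|
      ≤ (2 * F * Real.sqrt (∫ x, ‖laplacian w x‖ ^ 2) + L₂ * Real.sqrt (gradNormSq w))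
        * Real.sqrt (∫ x, ‖laplacian w x‖ ^ 2) := by
  have hΔw : IsSmooth (laplacian w) := hw.laplacian
  have hcw : IsSmooth (convect v w) := hv.convect hw
  have hL20 : 0 ≤ L₂ := (norm_nonneg _).trans (hL₂ (0 : UnitAddTorus d))
  -- Green + skew identity
  have hgreen : ∫ x, ⟪convect v w x, laplacian (laplacian w) x⟫
      = ∫ x, ⟪laplacian (convect v w) x, laplacian w x⟫ :=
    (integral_inner_laplacian_comm hcw hΔw).symm
  set R : UnitAddTorus d → EuclideanSpace ℝ d := fun x =>
    (2:ℝ) • (∑ m, convect (partialDeriv m v) (partialDeriv m w) x) + convect (laplacian v) w x with hR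
  have hskew : ∫ x, ⟪laplacian (convect v w) x, laplacian w x⟫ = ∫ x, ⟪R x, laplacian w x⟫ :=
    integral_inner_laplacian_convect_laplacian hv hdiv hw
  rw [hgreen, hskew]
  -- the scalar densities
  set h : UnitAddTorus d → ℝ := fun x =>
    Real.sqrt (∑ m, ∑ j, ‖partialDeriv j (partialDeriv m w) x‖ ^ 2) with hh
  set g : UnitAddTorus d → ℝ := fun x => Real.sqrt (∑ j, ‖partialDeriv j w x‖ ^ 2) with hg
  set c : UnitAddTorus d → ℝ := fun x => ‖laplacian w x‖ with hc
  have hh0 : ∀ x, 0 ≤ h x := fun x => Real.sqrt_nonneg _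
  have hg0 : ∀ x, 0 ≤ g x := fun x => Real.sqrt_nonneg _
  have hc0 : ∀ x, 0 ≤ c x := fun x => norm_nonneg _
  -- pointwise bound on `R`
  have hRpt : ∀ x, ‖R x‖ ≤ 2 * F * h x + L₂ * g x := by
    intro x
    have hS : ‖∑ m, convect (partialDeriv m v) (partialDeriv m w) x‖ ≤ F * h x := by
      have h1 := norm_sum_convect_le_sqrt_mul_sqrt (fun m => partialDeriv m v)
        (B := fun m => partialDeriv m w) (fun m => (hw.partialDeriv m).isContDiff (by simp)) x
      have h2 : Real.sqrt (∑ m, ‖partialDeriv m v x‖ ^ 2) ≤ F := (Real.sqrt_le_sqrt (hF x)).trans_eq (Real.sqrt_sq hF0)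
      exact h1.trans (mul_le_mul_of_nonneg_right h2 (hh0 x))
    have h1 : ‖(2:ℝ) • (∑ m, convect (partialDeriv m v) (partialDeriv m w) x)‖ ≤ 2 * F * h x := by
      rw [norm_smul, Real.norm_two]; nlinarith [hS]
    have h2 : ‖convect (laplacian v) w x‖ ≤ L₂ * g x := by
      have hcv := norm_convect_le_norm_mul_sqrt (hw.isContDiff (by simp)) (laplacian v) x
      exact hcv.trans (mul_le_mul_of_nonneg_right (hL₂ x) (hg0 x))
    exact (norm_add_le _ _).trans (add_le_add h1 h2)
  -- continuity / integrability
  have hRs : IsSmooth R := by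
    have hs : IsSmooth (fun x => ∑ m, convect (partialDeriv m v) (partialDeriv m w) x) := by
      have hl : lift (fun x => ∑ m, convect (partialDeriv m v) (partialDeriv m w) x)
          = fun z => ∑ m, lift (convect (partialDeriv m v) (partialDeriv m w)) z := rfl
      unfold IsSmooth; rw [hl]
      exact ContDiff.sum fun m _ => ((hv.partialDeriv m).convect (hw.partialDeriv m))
    have h := (hs.smul (2:ℝ)).add (hv.laplacian.convect hw)
    have e : R = ((2:ℝ) • (fun x => ∑ m, convect (partialDeriv m v) (partialDeriv m w) x)
        + convect (laplacian v) w) := by funext x; simp [hR]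
    rw [e]; exact h
  have hch : Continuous h := by
    refine Real.continuous_sqrt.comp ?_
    exact continuous_finsetSum _ fun m _ => continuous_finsetSum _ fun j _ =>
      ((((hw.partialDeriv m).partialDeriv j).continuous).norm).pow 2
  have hcg : Continuous g := continuous_sqrt_sum_norm_partialDeriv_sq hw
  have hcc : Continuous c := hΔw.continuous.norm
  have hIh : Integrable (fun x => h x * c x) volume :=
    (hch.mul hcc).integrable_of_hasCompactSupport (HasCompactSupport.of_compactSpace _)
  have hIg : Integrable (fun x => g x * c x) volume :=
    (hcg.mul hcc).integrable_of_hasCompactSupport (HasCompactSupport.of_compactSpace _)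
  -- |∫⟪R, Δw⟫| ≤ ∫ ‖R‖ c ≤ 2F ∫ h c + L₂ ∫ g c
  have hint_le : |∫ x, ⟪R x, laplacian w x⟫| ≤ ∫ x, ‖R x‖ * c x := by
    refine (abs_integral_le_integral_abs).trans (integral_mono_of_nonneg
      (ae_of_all _ fun x => abs_nonneg _) ?_ (ae_of_all _ fun x => abs_real_inner_le_norm _ _))
    exact (hRs.continuous.norm.mul hcc).integrable_of_hasCompactSupport
      (HasCompactSupport.of_compactSpace _)
  have hmono : ∫ x, ‖R x‖ * c x ≤ ∫ x, (2 * F * (h x * c x) + L₂ * (g x * c x)) := by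
    refine integral_mono_of_nonneg (ae_of_all _ fun x => mul_nonneg (norm_nonneg _) (hc0 x))
      ((hIh.const_mul _).add (hIg.const_mul _)) (ae_of_all _ fun x => ?_)
    have hx := mul_le_mul_of_nonneg_right (hRpt x) (hc0 x)
    have e : (2 * F * h x + L₂ * g x) * c x = 2 * F * (h x * c x) + L₂ * (g x * c x) := by ring
    show ‖R x‖ * c x ≤ 2 * F * (h x * c x) + L₂ * (g x * c x)
    rw [← e]; exact hx
  have hsplit : ∫ x, (2 * F * (h x * c x) + L₂ * (g x * c x))
      = 2 * F * (∫ x, h x * c x) + L₂ * (∫ x, g x * c x) := by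
    rw [integral_add (hIh.const_mul _) (hIg.const_mul _), integral_const_mul, integral_const_mul]
  -- Cauchy–Schwarz in L² for the two products (real-valued densities, ‖h x‖ = h x etc.)
  have hmh : MemLp h 2 volume := hch.memLp_of_hasCompactSupport (HasCompactSupport.of_compactSpace _)
  have hmg : MemLp g 2 volume := hcg.memLp_of_hasCompactSupport (HasCompactSupport.of_compactSpace _)
  have hmc : MemLp c 2 volume := hcc.memLp_of_hasCompactSupport (HasCompactSupport.of_compactSpace _)
  have habs : ∀ {f : UnitAddTorus d → ℝ}, (∀ x, 0 ≤ f x) → ∀ x, ‖f x‖ = f x :=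
    fun hf x => by rw [Real.norm_eq_abs, abs_of_nonneg (hf x)]
  have hCSh : ∫ x, h x * c x ≤ Real.sqrt (∫ x, h x ^ 2) * Real.sqrt (∫ x, c x ^ 2) := by
    have h1 := integral_norm_mul_norm_le_sqrt_sq_mul_sqrt_sq hmh hmc
    simp only [habs hh0, habs hc0] at h1
    exact h1
  have hCSg : ∫ x, g x * c x ≤ Real.sqrt (∫ x, g x ^ 2) * Real.sqrt (∫ x, c x ^ 2) := by
    have h1 := integral_norm_mul_norm_le_sqrt_sq_mul_sqrt_sq hmg hmc
    simp only [habs hg0, habs hc0] at h1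
    exact h1
  -- identify ∫ h² = ∫‖Δw‖², ∫ g² = gradNormSq w, ∫ c² = ∫‖Δw‖²
  have hh2 : ∫ x, h x ^ 2 = ∫ x, ‖laplacian w x‖ ^ 2 := by
    have e : (fun x => h x ^ 2) = fun x => ∑ m, ∑ j, ‖partialDeriv j (partialDeriv m w) x‖ ^ 2 := by
      funext x; exact Real.sq_sqrt (Finset.sum_nonneg fun m _ => Finset.sum_nonneg fun j _ => sq_nonneg _)
    rw [e, ← sum_gradNormSq_partialDeriv_eq hw]
    have hiam : ∀ m i, Integrable (fun x => ‖partialDeriv i (partialDeriv m w) x‖ ^ 2) volume :=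
      fun m i => ((((hw.partialDeriv m).partialDeriv i).continuous.norm).pow 2).integrable_of_hasCompactSupport
        (HasCompactSupport.of_compactSpace _)
    rw [integral_finsetSum _ fun m _ => integrable_finsetSum _ fun j _ => hiam m j]
    refine Finset.sum_congr rfl fun m _ => ?_
    rw [gradNormSq, integral_finsetSum _ fun j _ => hiam m j]
  have hg2 : ∫ x, g x ^ 2 = gradNormSq w := by
    have e : (fun x => g x ^ 2) = fun x => ∑ j, ‖partialDeriv j w x‖ ^ 2 := by
      funext x; exact Real.sq_sqrt (Finset.sum_nonneg fun j _ => sq_nonneg _)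
    rw [e, gradNormSq]
  have hc2 : ∫ x, c x ^ 2 = ∫ x, ‖laplacian w x‖ ^ 2 := rfl
  rw [hh2] at hCSh
  rw [hg2] at hCSg
  have hF2 : 0 ≤ 2 * F := by linarith
  calc |∫ x, ⟪R x, laplacian w x⟫|
      ≤ ∫ x, ‖R x‖ * c x := hint_le
    _ ≤ ∫ x, (2 * F * (h x * c x) + L₂ * (g x * c x)) := hmono
    _ = 2 * F * (∫ x, h x * c x) + L₂ * (∫ x, g x * c x) := hsplit
    _ ≤ 2 * F * (Real.sqrt (∫ x, ‖laplacian w x‖ ^ 2) * Real.sqrt (∫ x, c x ^ 2))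
        + L₂ * (Real.sqrt (gradNormSq w) * Real.sqrt (∫ x, c x ^ 2)) :=
        add_le_add (mul_le_mul_of_nonneg_left hCSh hF2) (mul_le_mul_of_nonneg_left hCSg hL20)
    _ = (2 * F * Real.sqrt (∫ x, ‖laplacian w x‖ ^ 2) + L₂ * Real.sqrt (gradNormSq w))
        * Real.sqrt (∫ x, ‖laplacian w x‖ ^ 2) := by rw [hc2]; ring

/-! ## The stretching half -/

/-- **Sharp `H²` stretching flux (Frobenius host constants).** For smooth `v` with the strain bound
`|⟪(a·∇)v(x), a⟫| ≤ s‖a‖²`, the Hessian bound `∑ₘ∑ⱼ‖∂ⱼ∂ₘv(x)‖² ≤ P²` and `∑ⱼ‖∂ⱼΔv(x)‖² ≤ Q²`,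
and smooth `w` (no divergence condition):
`|∫ ⟪(w·∇)v, ΔΔw⟫| ≤ (Q‖w‖₂ + 2P‖∇w‖₂ + s‖Δw‖₂)·‖Δw‖₂`.
Green's identity and `Δ((w·∇)v) = (w·∇)Δv + 2∑ₘ(∂ₘw·∇)∂ₘv + (Δw·∇)v` (`laplacian_convect`); the last
(top-order) term is paired with `Δw` through the STRAIN form only, the two lower-order terms by
Frobenius Cauchy–Schwarz. -/
theorem abs_integral_inner_stretch_bilaplacian_le_frob {v w : UnitAddTorus d → EuclideanSpace ℝ d}
    (hv : IsSmooth v) (hw : IsSmooth w) {s P Q : ℝ} (hP0 : 0 ≤ P) (hQ0 : 0 ≤ Q)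
    (hS : ∀ (x : UnitAddTorus d) (a : EuclideanSpace ℝ d),
      |⟪∑ j, a j • partialDeriv j v x, a⟫| ≤ s * ‖a‖ ^ 2)
    (hP : ∀ x : UnitAddTorus d, ∑ m, ∑ j, ‖partialDeriv j (partialDeriv m v) x‖ ^ 2 ≤ P ^ 2)
    (hQ : ∀ x : UnitAddTorus d, ∑ j, ‖partialDeriv j (laplacian v) x‖ ^ 2 ≤ Q ^ 2) :
    |∫ x, ⟪convect w v x, laplacian (laplacian w) x⟫|
      ≤ (Q * Real.sqrt (∫ x, ‖w x‖ ^ 2) + 2 * P * Real.sqrt (gradNormSq w)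
          + s * Real.sqrt (∫ x, ‖laplacian w x‖ ^ 2)) * Real.sqrt (∫ x, ‖laplacian w x‖ ^ 2) := by
  have hΔw : IsSmooth (laplacian w) := hw.laplacian
  have hΔv : IsSmooth (laplacian v) := hv.laplacian
  have hcw : IsSmooth (convect w v) := hw.convect hv
  set Y : ℝ := ∫ x, ‖laplacian w x‖ ^ 2 with hY
  have hY0 : 0 ≤ Y := integral_nonneg fun x => sq_nonneg _
  -- Green
  have hgreen : ∫ x, ⟪convect w v x, laplacian (laplacian w) x⟫
      = ∫ x, ⟪laplacian (convect w v) x, laplacian w x⟫ :=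
    (integral_inner_laplacian_comm hcw hΔw).symm
  -- split `Δ((w·∇)v)` into the lower-order part and the top-order (strain) part
  set Rl : UnitAddTorus d → EuclideanSpace ℝ d := fun x =>
    convect w (laplacian v) x + (2:ℝ) • (∑ m, convect (partialDeriv m w) (partialDeriv m v) x) with hRl
  set T : UnitAddTorus d → EuclideanSpace ℝ d := fun x => convect (laplacian w) v x with hT
  have hdec : ∀ x, laplacian (convect w v) x = Rl x + T x := by
    intro x; simp only [hRl, hT]; exact laplacian_convect hw hv x
  have hRls : IsSmooth Rl := by
    have hs : IsSmooth (fun x => ∑ m, convect (partialDeriv m w) (partialDeriv m v) x) := by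
      have hl : lift (fun x => ∑ m, convect (partialDeriv m w) (partialDeriv m v) x)
          = fun z => ∑ m, lift (convect (partialDeriv m w) (partialDeriv m v)) z := rfl
      unfold IsSmooth; rw [hl]
      exact ContDiff.sum fun m _ => ((hw.partialDeriv m).convect (hv.partialDeriv m))
    have h := (hw.convect hΔv).add (hs.smul (2:ℝ))
    have e : Rl = (convect w (laplacian v)
        + (2:ℝ) • (fun x => ∑ m, convect (partialDeriv m w) (partialDeriv m v) x)) := by
      funext x; simp [hRl]
    rw [e]; exact h
  have hTs : IsSmooth T := hΔw.convect hv
  have hiRl : Integrable (fun x => ⟪Rl x, laplacian w x⟫) volume :=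
    ((hRls.continuous).inner hΔw.continuous).integrable_of_hasCompactSupport
      (HasCompactSupport.of_compactSpace _)
  have hiT : Integrable (fun x => ⟪T x, laplacian w x⟫) volume :=
    ((hTs.continuous).inner hΔw.continuous).integrable_of_hasCompactSupport
      (HasCompactSupport.of_compactSpace _)
  have hsplit : ∫ x, ⟪laplacian (convect w v) x, laplacian w x⟫
      = (∫ x, ⟪Rl x, laplacian w x⟫) + ∫ x, ⟪T x, laplacian w x⟫ := by
    have e : (fun x => ⟪laplacian (convect w v) x, laplacian w x⟫)
        = fun x => ⟪Rl x, laplacian w x⟫ + ⟪T x, laplacian w x⟫ := by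
      funext x; rw [hdec x, inner_add_left]
    rw [e]; exact integral_add hiRl hiT
  -- densities
  set a : UnitAddTorus d → ℝ := fun x => ‖w x‖ with ha
  set g : UnitAddTorus d → ℝ := fun x => Real.sqrt (∑ j, ‖partialDeriv j w x‖ ^ 2) with hg
  set c : UnitAddTorus d → ℝ := fun x => ‖laplacian w x‖ with hc
  have ha0 : ∀ x, 0 ≤ a x := fun x => norm_nonneg _
  have hg0 : ∀ x, 0 ≤ g x := fun x => Real.sqrt_nonneg _
  have hc0 : ∀ x, 0 ≤ c x := fun x => norm_nonneg _
  have hca : Continuous a := hw.continuous.norm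
  have hcg : Continuous g := continuous_sqrt_sum_norm_partialDeriv_sq hw
  have hcc : Continuous c := hΔw.continuous.norm
  have hIa : Integrable (fun x => a x * c x) volume :=
    (hca.mul hcc).integrable_of_hasCompactSupport (HasCompactSupport.of_compactSpace _)
  have hIg : Integrable (fun x => g x * c x) volume :=
    (hcg.mul hcc).integrable_of_hasCompactSupport (HasCompactSupport.of_compactSpace _)
  have hIcc : Integrable (fun x => c x ^ 2) volume :=
    (hcc.pow 2).integrable_of_hasCompactSupport (HasCompactSupport.of_compactSpace _)
  -- (i) lower-order part: pointwise ‖Rl‖ ≤ Q a + 2 P g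
  have hRlpt : ∀ x, ‖Rl x‖ ≤ Q * a x + 2 * P * g x := by
    intro x
    have h1 : ‖convect w (laplacian v) x‖ ≤ Q * a x := by
      have hcv := norm_convect_le_norm_mul_sqrt (hΔv.isContDiff (by simp)) w x
      have h2 : Real.sqrt (∑ j, ‖partialDeriv j (laplacian v) x‖ ^ 2) ≤ Q := (Real.sqrt_le_sqrt (hQ x)).trans_eq (Real.sqrt_sq hQ0)
      calc ‖convect w (laplacian v) x‖ ≤ ‖w x‖ * Real.sqrt (∑ j, ‖partialDeriv j (laplacian v) x‖ ^ 2) := hcv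
        _ ≤ ‖w x‖ * Q := mul_le_mul_of_nonneg_left h2 (norm_nonneg _)
        _ = Q * a x := by simp only [ha]; ring
    have hS : ‖∑ m, convect (partialDeriv m w) (partialDeriv m v) x‖ ≤ g x * P := by
      have h1 := norm_sum_convect_le_sqrt_mul_sqrt (fun m => partialDeriv m w)
        (B := fun m => partialDeriv m v) (fun m => (hv.partialDeriv m).isContDiff (by simp)) x
      have h2 : Real.sqrt (∑ m, ∑ j, ‖partialDeriv j (partialDeriv m v) x‖ ^ 2) ≤ P :=
        (Real.sqrt_le_sqrt (hP x)).trans_eq (Real.sqrt_sq hP0)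
      exact h1.trans (mul_le_mul_of_nonneg_left h2 (hg0 x))
    have h2 : ‖(2:ℝ) • (∑ m, convect (partialDeriv m w) (partialDeriv m v) x)‖ ≤ 2 * P * g x := by
      rw [norm_smul, Real.norm_two]; nlinarith [hS]
    exact (norm_add_le _ _).trans (add_le_add h1 h2)
  have hRl_int : |∫ x, ⟪Rl x, laplacian w x⟫| ≤ Q * (∫ x, a x * c x) + 2 * P * (∫ x, g x * c x) := by
    have h1 : |∫ x, ⟪Rl x, laplacian w x⟫| ≤ ∫ x, ‖Rl x‖ * c x := by
      refine (abs_integral_le_integral_abs).trans (integral_mono_of_nonneg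
        (ae_of_all _ fun x => abs_nonneg _) ?_ (ae_of_all _ fun x => abs_real_inner_le_norm _ _))
      exact (hRls.continuous.norm.mul hcc).integrable_of_hasCompactSupport
        (HasCompactSupport.of_compactSpace _)
    have h2 : ∫ x, ‖Rl x‖ * c x ≤ ∫ x, (Q * (a x * c x) + 2 * P * (g x * c x)) := by
      refine integral_mono_of_nonneg (ae_of_all _ fun x => mul_nonneg (norm_nonneg _) (hc0 x))
        ((hIa.const_mul _).add (hIg.const_mul _)) (ae_of_all _ fun x => ?_)
      have hx := mul_le_mul_of_nonneg_right (hRlpt x) (hc0 x)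
      have e : (Q * a x + 2 * P * g x) * c x = Q * (a x * c x) + 2 * P * (g x * c x) := by ring
      show ‖Rl x‖ * c x ≤ Q * (a x * c x) + 2 * P * (g x * c x)
      rw [← e]; exact hx
    have h3 : ∫ x, (Q * (a x * c x) + 2 * P * (g x * c x))
        = Q * (∫ x, a x * c x) + 2 * P * (∫ x, g x * c x) := by
      rw [integral_add (hIa.const_mul _) (hIg.const_mul _), integral_const_mul, integral_const_mul]
    exact h1.trans (h2.trans (le_of_eq h3))
  -- (ii) top-order part through the strain form: |⟪(Δw·∇)v, Δw⟫| ≤ s ‖Δw‖² pointwise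
  have hTpt : ∀ x, |⟪T x, laplacian w x⟫| ≤ s * c x ^ 2 := by
    intro x
    have e : T x = ∑ j, (laplacian w x) j • partialDeriv j v x := by
      simp only [hT]; exact fderiv_apply_eq_sum_partialDeriv (hv.isContDiff (by simp)) x (laplacian w x)
    rw [e]; exact hS x (laplacian w x)
  have hT_int : |∫ x, ⟪T x, laplacian w x⟫| ≤ s * Y := by
    have h1 : |∫ x, ⟪T x, laplacian w x⟫| ≤ ∫ x, s * c x ^ 2 := by
      refine (abs_integral_le_integral_abs).trans (integral_mono_of_nonneg
        (ae_of_all _ fun x => abs_nonneg _) (hIcc.const_mul _) (ae_of_all _ fun x => hTpt x))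
    rw [integral_const_mul] at h1
    exact h1
  -- Cauchy–Schwarz for the two lower-order products
  have habs : ∀ {f : UnitAddTorus d → ℝ}, (∀ x, 0 ≤ f x) → ∀ x, ‖f x‖ = f x :=
    fun hf x => by rw [Real.norm_eq_abs, abs_of_nonneg (hf x)]
  have hma : MemLp a 2 volume := hca.memLp_of_hasCompactSupport (HasCompactSupport.of_compactSpace _)
  have hmg : MemLp g 2 volume := hcg.memLp_of_hasCompactSupport (HasCompactSupport.of_compactSpace _)
  have hmc : MemLp c 2 volume := hcc.memLp_of_hasCompactSupport (HasCompactSupport.of_compactSpace _)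
  have hCSa : ∫ x, a x * c x ≤ Real.sqrt (∫ x, a x ^ 2) * Real.sqrt (∫ x, c x ^ 2) := by
    have h1 := integral_norm_mul_norm_le_sqrt_sq_mul_sqrt_sq hma hmc
    simp only [habs ha0, habs hc0] at h1
    exact h1
  have hCSg : ∫ x, g x * c x ≤ Real.sqrt (∫ x, g x ^ 2) * Real.sqrt (∫ x, c x ^ 2) := by
    have h1 := integral_norm_mul_norm_le_sqrt_sq_mul_sqrt_sq hmg hmc
    simp only [habs hg0, habs hc0] at h1
    exact h1
  have hg2 : ∫ x, g x ^ 2 = gradNormSq w := by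
    have e : (fun x => g x ^ 2) = fun x => ∑ j, ‖partialDeriv j w x‖ ^ 2 := by
      funext x; exact Real.sq_sqrt (Finset.sum_nonneg fun j _ => sq_nonneg _)
    rw [e, gradNormSq]
  have ha2 : ∫ x, a x ^ 2 = ∫ x, ‖w x‖ ^ 2 := rfl
  have hc2 : ∫ x, c x ^ 2 = Y := rfl
  rw [hg2, hc2] at hCSg
  rw [ha2, hc2] at hCSa
  have hsY : s * Y = s * Real.sqrt Y * Real.sqrt Y := by
    rw [mul_assoc, Real.mul_self_sqrt hY0]
  have h2P : 0 ≤ 2 * P := by linarith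
  calc |∫ x, ⟪convect w v x, laplacian (laplacian w) x⟫|
      = |(∫ x, ⟪Rl x, laplacian w x⟫) + ∫ x, ⟪T x, laplacian w x⟫| := by rw [hgreen, hsplit]
    _ ≤ |∫ x, ⟪Rl x, laplacian w x⟫| + |∫ x, ⟪T x, laplacian w x⟫| := abs_add_le _ _
    _ ≤ (Q * (∫ x, a x * c x) + 2 * P * (∫ x, g x * c x)) + s * Y := add_le_add hRl_int hT_int
    _ ≤ (Q * (Real.sqrt (∫ x, ‖w x‖ ^ 2) * Real.sqrt Y) + 2 * P * (Real.sqrt (gradNormSq w) * Real.sqrt Y))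
        + s * Real.sqrt Y * Real.sqrt Y := by
        rw [← hsY]
        exact add_le_add (add_le_add (mul_le_mul_of_nonneg_left hCSa hQ0)
          (mul_le_mul_of_nonneg_left hCSg h2P)) le_rfl
    _ = (Q * Real.sqrt (∫ x, ‖w x‖ ^ 2) + 2 * P * Real.sqrt (gradNormSq w)
          + s * Real.sqrt Y) * Real.sqrt Y := by ring

end Summit.NavierStokesRegularity.FluidComputer.SharpH2Fluxes
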